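import Summits.CriticalPhenomena.CardyFormulaZ2.Theorems.CardyIKTransportIKLinearTransportStubPinnedSampler

/-!
# Stub `stub_PinnedSampler` — coupling from the past along rows, part 1 (core lemmas)

Theorem-only support file (`--supports stmt-CriticalPhenomena-5076`, registered sub-goal
`ps2_measure_ext_rows`). The dynamical form of the remaining content of `stub_PinnedSampler` is a
ROW-RESAMPLING DYNAMICS `Φ y p u z` (resample the middle data of row `y` — cell `(i+1, y)`, faces `(i, y)`,
`(i+1, y)` — of `z` in the environment `p`, a value of the pinned statistic `(eraseMid i, stripDiagram i)`,
reading the fresh bits `u`) together with CERTIFIED COALESCENCE events `Coal y m` (the sweep of rows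
`y-m, …, y` has forgotten its start at row `y`). The Propp–Wilson sampler reads, at every row, the bits of
the first certified sweep. This file proves the model-free lemmas the identification of its law
(`…StubPinnedSamplerCFTPLaw.lean`) and the assembly of the pinned sampler (`…StubPinnedSamplerCFTP.lean`)
consume:

* `ps2_measure_ext_rows` — two finite measures on `Y × Obs` agreeing on every measurable event whose
  `Obs`-sections read only the rows `[-k, k]`, for every `k`, are equal (π-system generating the product
  σ-algebra);
* sweeps `T n a p u z := ((fun q => (q.1 + 1, Φ q.1 p u q.2))^[n] (a, z)).2` (rows `a, …, a+n-1` in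
  increasing order; no definition is introduced, the lemmas carry the defining equation `hT`): splitting,
  off-row identity, row stability, joint measurability, preservation of the pinned statistic, vertical
  covariance;
* certified coalescence: deeper sweeps from any start reproduce the certified bits
  (`ps2_sweep_sound_of_le`), and the first-certified-depth bits agree with every certified sweep
  (`ps2_cftp_bits_eq`).
-/

noncomputable section

namespace Summit.CriticalPhenomena.CardyFormulaZ2.Theorems.IKLinearTransport.PinnedDiagramExchange

open scoped Classical MeasureTheory ENNReal
open Set MeasureTheory
open Literature.Probability.Percolation Literature.Probability.LatticeModels

section Ext

variable {Y : Type*} [MeasurableSpace Y]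

/-- Row-local events on `Y × Obs` form a π-system. [folklore] -/
theorem ps2_isPiSystem_rowLocal :
    IsPiSystem {D : Set (Y × Obs) | MeasurableSet D ∧ ∃ k : ℕ, ∀ (p : Y) (z z' : Obs),
      (∀ w : Site 2, -(k : ℤ) ≤ w 1 → w 1 ≤ k → (w ∈ z.1 ↔ w ∈ z'.1) ∧ (w ∈ z.2 ↔ w ∈ z'.2)) →
        ((p, z) ∈ D ↔ (p, z') ∈ D)} := by
  rintro D ⟨hDm, k, hD⟩ D' ⟨hD'm, k', hD'⟩ -
  refine ⟨hDm.inter hD'm, max k k', fun p z z' h => ?_⟩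
  have h1 := hD p z z' fun w hw hw' => h w (by push_cast; omega) (by push_cast; omega)
  have h2 := hD' p z z' fun w hw hw' => h w (by push_cast; omega) (by push_cast; omega)
  simp only [mem_inter_iff, h1, h2]

/-- The row-local events generate the product σ-algebra of `Y × Obs`. [folklore] -/
theorem ps2_generateFrom_rowLocal :
    (inferInstance : MeasurableSpace (Y × Obs)) =
      MeasurableSpace.generateFrom {D : Set (Y × Obs) | MeasurableSet D ∧ ∃ k : ℕ, ∀ (p : Y) (z z' : Obs),
        (∀ w : Site 2, -(k : ℤ) ≤ w 1 → w 1 ≤ k → (w ∈ z.1 ↔ w ∈ z'.1) ∧ (w ∈ z.2 ↔ w ∈ z'.2)) →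
          ((p, z) ∈ D ↔ (p, z') ∈ D)} := by
  set C := {D : Set (Y × Obs) | MeasurableSet D ∧ ∃ k : ℕ, ∀ (p : Y) (z z' : Obs),
        (∀ w : Site 2, -(k : ℤ) ≤ w 1 → w 1 ≤ k → (w ∈ z.1 ↔ w ∈ z'.1) ∧ (w ∈ z.2 ↔ w ∈ z'.2)) →
          ((p, z) ∈ D ↔ (p, z') ∈ D)} with hC
  refine le_antisymm ?_ (MeasurableSpace.generateFrom_le fun D hD => hD.1)
  -- the identity is measurable from `generateFrom C` to the product σ-algebra
  have hfst : Measurable[MeasurableSpace.generateFrom C] (Prod.fst : Y × Obs → Y) := by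
    intro B hB
    refine MeasurableSpace.measurableSet_generateFrom ⟨measurable_fst hB, 0, fun p z z' _ => Iff.rfl⟩
  have hcoord : ∀ (w : Site 2) (b : Bool),
      Measurable[MeasurableSpace.generateFrom C]
        (fun q : Y × Obs => if b then w ∈ q.2.1 else w ∈ q.2.2) := by
    intro w b T _
    refine MeasurableSpace.measurableSet_generateFrom ⟨?_, (w 1).natAbs, fun p z z' h => ?_⟩
    · have : Measurable fun q : Y × Obs => if b then w ∈ q.2.1 else w ∈ q.2.2 := by
        cases b
        · exact (measurable_set_mem w).comp (measurable_snd.comp measurable_snd)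
        · exact (measurable_set_mem w).comp (measurable_fst.comp measurable_snd)
      exact this trivial
    · have hw := h w (by omega) (by omega)
      cases b <;> simp only [mem_preimage, Bool.false_eq_true, ↓reduceIte, hw.1, hw.2]
  have hsnd1 : Measurable[MeasurableSpace.generateFrom C] (fun q : Y × Obs => q.2.1) :=
    (@measurable_set_iff _ _ (MeasurableSpace.generateFrom C) _).2 fun w => by
      simpa using hcoord w true
  have hsnd2 : Measurable[MeasurableSpace.generateFrom C] (fun q : Y × Obs => q.2.2) :=
    (@measurable_set_iff _ _ (MeasurableSpace.generateFrom C) _).2 fun w => by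
      simpa using hcoord w false
  have hid : Measurable[MeasurableSpace.generateFrom C] (id : Y × Obs → Y × Obs) :=
    hfst.prodMk (hsnd1.prodMk hsnd2)
  rw [measurable_iff_comap_le, MeasurableSpace.comap_id] at hid
  exact hid

/-- EXTENSIONALITY BY ROW-LOCAL EVENTS (registered sub-goal): two finite measures on `Y × Obs` that agree on
every measurable event whose `Obs`-sections are determined by the rows `[-k, k]`, for every `k`, are
equal. [folklore] -/
theorem ps2_measure_ext_rows :
    ∀ {Y : Type*} [MeasurableSpace Y] (μ ν : MeasureTheory.Measure (Y × Obs)),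
      MeasureTheory.IsFiniteMeasure μ → MeasureTheory.IsFiniteMeasure ν →
      (∀ (k : ℕ) (D : Set (Y × Obs)), MeasurableSet D →
        (∀ (p : Y) (z z' : Obs), (∀ w : Site 2, -(k : ℤ) ≤ w 1 → w 1 ≤ k →
          (w ∈ z.1 ↔ w ∈ z'.1) ∧ (w ∈ z.2 ↔ w ∈ z'.2)) → ((p, z) ∈ D ↔ (p, z') ∈ D)) → μ D = ν D) →
      μ = ν := by
  intro Y _ μ ν hμ hν h
  refine ext_of_generate_finite _ ps2_generateFrom_rowLocal ps2_isPiSystem_rowLocal ?_ ?_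
  · rintro D ⟨hDm, k, hD⟩
    exact h k D hDm hD
  · exact h 0 univ MeasurableSet.univ fun _ _ _ _ => Iff.rfl

end Ext

/-! ## Row sweeps of a row-resampling dynamics `Φ`

`Φ y p u z` resamples the middle data of row `y` (cell `(i+1, y)`, faces `(i, y)`, `(i+1, y)`) of the
configuration `z`, in the environment `p` (a value of the pinned statistic), reading the fresh bits `u`.
The SWEEP `T n a p u z := ((fun q => (q.1 + 1, Φ q.1 p u q.2))^[n] (a, z)).2` resamples the rows
`a, a+1, …, a+n-1` in increasing order. No definition is introduced: the lemmas take `T` together with its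
defining equation `hT`. -/

section Sweep

variable {i : ℤ} {Φ : ℤ → Obs × Set (Site 2 × Site 2) → Rnd → Obs → Obs}
  {T : ℕ → ℤ → Obs × Set (Site 2 × Site 2) → Rnd → Obs → Obs}

/-- Coordinates of the cell `![a, b]`. [folklore] -/
theorem ps2_vec2_apply (a b : ℤ) : (![a, b] : Site 2) 0 = a ∧ (![a, b] : Site 2) 1 = b := ⟨rfl, rfl⟩

/-- A cell is the vector of its two coordinates. [folklore] -/
theorem ps2_eq_vec2 (w : Site 2) : w = ![w 0, w 1] := by
  ext j; fin_cases j <;> rfl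

/-- The row counter of the sweep iteration. [folklore] -/
theorem ps2_step_iterate_fst (p : Obs × Set (Site 2 × Site 2)) (u : Rnd) (n : ℕ) (a : ℤ) (z : Obs) :
    ((fun q : ℤ × Obs => (q.1 + 1, Φ q.1 p u q.2))^[n] (a, z)).1 = a + n := by
  induction n with
  | zero => simp
  | succ n ih =>
    rw [Function.iterate_succ_apply']
    simp only [ih, Nat.cast_add, Nat.cast_one]
    ring

/-- The empty sweep. [folklore] -/
theorem ps2_sweep_zero
    (hT : ∀ n a p u z, T n a p u z = ((fun q : ℤ × Obs => (q.1 + 1, Φ q.1 p u q.2))^[n] (a, z)).2)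
    (a : ℤ) (p : Obs × Set (Site 2 × Site 2)) (u : Rnd) (z : Obs) : T 0 a p u z = z := by
  rw [hT]; rfl

/-- One more row. [folklore] -/
theorem ps2_sweep_succ
    (hT : ∀ n a p u z, T n a p u z = ((fun q : ℤ × Obs => (q.1 + 1, Φ q.1 p u q.2))^[n] (a, z)).2)
    (n : ℕ) (a : ℤ) (p : Obs × Set (Site 2 × Site 2)) (u : Rnd) (z : Obs) :
    T (n + 1) a p u z = Φ (a + n) p u (T n a p u z) := by
  rw [hT, hT, Function.iterate_succ_apply', ps2_step_iterate_fst]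

/-- SPLITTING of sweeps: rows `a … a+n-1` first, then rows `a+n … a+n+k-1`. [folklore] -/
theorem ps2_sweep_add
    (hT : ∀ n a p u z, T n a p u z = ((fun q : ℤ × Obs => (q.1 + 1, Φ q.1 p u q.2))^[n] (a, z)).2)
    (n k : ℕ) (a : ℤ) (p : Obs × Set (Site 2 × Site 2)) (u : Rnd) (z : Obs) :
    T (n + k) a p u z = T k (a + n) p u (T n a p u z) := by
  have hpair : (fun q : ℤ × Obs => (q.1 + 1, Φ q.1 p u q.2))^[n] (a, z) = (a + n, T n a p u z) :=
    Prod.ext (ps2_step_iterate_fst p u n a z) (by rw [hT])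
  rw [hT (n + k), add_comm n k, Function.iterate_add_apply, hpair, ← hT]

/-- A sweep rewrites only the middle data of the rows it visits. [folklore] -/
theorem ps2_sweep_offRows
    (hT : ∀ n a p u z, T n a p u z = ((fun q : ℤ × Obs => (q.1 + 1, Φ q.1 p u q.2))^[n] (a, z)).2)
    (hW : ∀ y p u z, (∀ w : Site 2, w ≠ ![i + 1, y] → (w ∈ (Φ y p u z).1 ↔ w ∈ z.1)) ∧
      (∀ f : Site 2, f ≠ ![i, y] → f ≠ ![i + 1, y] → (f ∈ (Φ y p u z).2 ↔ f ∈ z.2)))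
    (n : ℕ) (a : ℤ) (p : Obs × Set (Site 2 × Site 2)) (u : Rnd) (z : Obs) (w : Site 2) :
    (¬ (w 0 = i + 1 ∧ a ≤ w 1 ∧ w 1 < a + n) → (w ∈ (T n a p u z).1 ↔ w ∈ z.1)) ∧
    (¬ ((w 0 = i ∨ w 0 = i + 1) ∧ a ≤ w 1 ∧ w 1 < a + n) → (w ∈ (T n a p u z).2 ↔ w ∈ z.2)) := by
  induction n with
  | zero => simp [ps2_sweep_zero hT]
  | succ n ih =>
    rw [ps2_sweep_succ hT]
    obtain ⟨ih1, ih2⟩ := ih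
    refine ⟨fun h => ?_, fun h => ?_⟩
    · have hne : w ≠ ![i + 1, a + n] := by
        rintro rfl
        exact h ⟨rfl, by change a ≤ a + n ∧ a + n < a + (n + 1 : ℕ); push_cast; omega⟩
      rw [(hW (a + n) p u _).1 w hne]
      exact ih1 fun h' => h ⟨h'.1, h'.2.1, by push_cast; omega⟩
    · have hne1 : w ≠ ![i, a + n] := by
        rintro rfl
        exact h ⟨Or.inl rfl, by change a ≤ a + n ∧ a + n < a + (n + 1 : ℕ); push_cast; omega⟩
      have hne2 : w ≠ ![i + 1, a + n] := by
        rintro rfl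
        exact h ⟨Or.inr rfl, by change a ≤ a + n ∧ a + n < a + (n + 1 : ℕ); push_cast; omega⟩
      rw [(hW (a + n) p u _).2 w hne1 hne2]
      exact ih2 fun h' => h ⟨h'.1, h'.2.1, by push_cast; omega⟩

/-- ROW STABILITY: once a row has been resampled, the rest of the sweep does not touch it. [folklore] -/
theorem ps2_sweep_rowStable
    (hT : ∀ n a p u z, T n a p u z = ((fun q : ℤ × Obs => (q.1 + 1, Φ q.1 p u q.2))^[n] (a, z)).2)
    (hW : ∀ y p u z, (∀ w : Site 2, w ≠ ![i + 1, y] → (w ∈ (Φ y p u z).1 ↔ w ∈ z.1)) ∧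
      (∀ f : Site 2, f ≠ ![i, y] → f ≠ ![i + 1, y] → (f ∈ (Φ y p u z).2 ↔ f ∈ z.2)))
    (k m : ℕ) (a : ℤ) (p : Obs × Set (Site 2 × Site 2)) (u : Rnd) (z : Obs) (w : Site 2)
    (hw : w 1 < a + k) :
    (w ∈ (T (k + m) a p u z).1 ↔ w ∈ (T k a p u z).1) ∧
      (w ∈ (T (k + m) a p u z).2 ↔ w ∈ (T k a p u z).2) := by
  rw [ps2_sweep_add hT]
  obtain ⟨h1, h2⟩ := ps2_sweep_offRows hT hW m (a + k) p u (T k a p u z) w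
  exact ⟨h1 fun h => by omega, h2 fun h => by omega⟩

/-- Sweeps are jointly measurable in (environment, bits, start). [folklore] -/
theorem ps2_sweep_measurable
    (hT : ∀ n a p u z, T n a p u z = ((fun q : ℤ × Obs => (q.1 + 1, Φ q.1 p u q.2))^[n] (a, z)).2)
    (hΦm : ∀ y, Measurable fun t : (Obs × Set (Site 2 × Site 2)) × (Rnd × Obs) => Φ y t.1 t.2.1 t.2.2)
    (n : ℕ) (a : ℤ) :
    Measurable fun t : (Obs × Set (Site 2 × Site 2)) × (Rnd × Obs) => T n a t.1 t.2.1 t.2.2 := by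
  induction n with
  | zero => simp only [ps2_sweep_zero hT]; fun_prop
  | succ n ih =>
    simp only [ps2_sweep_succ hT]
    exact (hΦm (a + n)).comp (measurable_fst.prodMk ((measurable_fst.comp measurable_snd).prodMk ih))

/-- A sweep started in its own environment keeps the pinned statistic (the row maps do). [folklore] -/
theorem ps2_sweep_stat
    (hT : ∀ n a p u z, T n a p u z = ((fun q : ℤ × Obs => (q.1 + 1, Φ q.1 p u q.2))^[n] (a, z)).2)
    (hW : ∀ y p u z, (∀ w : Site 2, w ≠ ![i + 1, y] → (w ∈ (Φ y p u z).1 ↔ w ∈ z.1)) ∧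
      (∀ f : Site 2, f ≠ ![i, y] → f ≠ ![i + 1, y] → (f ∈ (Φ y p u z).2 ↔ f ∈ z.2)))
    (hFib : ∀ y u z, stripDiagram i (Φ y (eraseMid i z, stripDiagram i z) u z) = stripDiagram i z)
    (n : ℕ) (a : ℤ) (u : Rnd) (z : Obs) :
    eraseMid i (T n a (eraseMid i z, stripDiagram i z) u z) = eraseMid i z ∧
      stripDiagram i (T n a (eraseMid i z, stripDiagram i z) u z) = stripDiagram i z := by
  induction n with
  | zero => simp [ps2_sweep_zero hT]
  | succ n ih =>
    rw [ps2_sweep_succ hT]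
    set z' := T n a (eraseMid i z, stripDiagram i z) u z with hz'
    rw [← ih.1, ← ih.2]
    refine ⟨eraseMid_eq_of_agree i _ _ (fun v hv => ?_) (fun f hf1 hf2 => ?_), hFib (a + n) u z'⟩
    · exact (hW (a + n) _ u z').1 v fun h => hv (by rw [h]; rfl)
    · exact (hW (a + n) _ u z').2 f (fun h => hf1 (by rw [h]; rfl)) (fun h => hf2 (by rw [h]; rfl))

/-- VERTICAL COVARIANCE of sweeps from that of the row maps. [folklore] -/
theorem ps2_sweep_cov
    (hT : ∀ n a p u z, T n a p u z = ((fun q : ℤ × Obs => (q.1 + 1, Φ q.1 p u q.2))^[n] (a, z)).2)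
    (hΦcov : ∀ (y k : ℤ) (x : Obs) (u : Rnd) (z : Obs),
      Φ y (eraseMid i (vshift k x), stripDiagram i (vshift k x)) (ushift k u) (vshift k z) =
        vshift k (Φ (y - k) (eraseMid i x, stripDiagram i x) u z))
    (n : ℕ) (a k : ℤ) (x : Obs) (u : Rnd) (z : Obs) :
    T n a (eraseMid i (vshift k x), stripDiagram i (vshift k x)) (ushift k u) (vshift k z) =
      vshift k (T n (a - k) (eraseMid i x, stripDiagram i x) u z) := by
  induction n with
  | zero => simp [ps2_sweep_zero hT]
  | succ n ih =>
    rw [ps2_sweep_succ hT, ps2_sweep_succ hT, ih, hΦcov]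
    congr 2
    ring

end Sweep

/-! ## Vertical shifts: coordinates, `eraseMid`, sup-balls -/

/-- Membership in a shifted configuration. [folklore] -/
theorem ps2_mem_vshift (m : ℤ) (x : Obs) (v : Site 2) :
    (v ∈ (vshift m x).1 ↔ v - ![0, m] ∈ x.1) ∧ (v ∈ (vshift m x).2 ↔ v - ![0, m] ∈ x.2) :=
  ⟨Iff.rfl, Iff.rfl⟩

/-- Coordinates of a shifted cell. [folklore] -/
theorem ps2_sub_vec_apply (v : Site 2) (m : ℤ) : (v - ![0, m]) 0 = v 0 ∧ (v - ![0, m]) 1 = v 1 - m := by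
  simp

/-- `eraseMid` commutes with vertical shifts. [folklore] -/
theorem ps2_eraseMid_vshift (i m : ℤ) (x : Obs) : eraseMid i (vshift m x) = vshift m (eraseMid i x) := by
  refine Prod.ext (Set.ext fun v => ?_) (Set.ext fun f => ?_)
  · simp only [eraseMid, vshift, mem_setOf_eq, Set.mem_preimage, (ps2_sub_vec_apply v m).1]
  · simp only [eraseMid, vshift, mem_setOf_eq, Set.mem_preimage, (ps2_sub_vec_apply f m).1]

/-! ## Certified coalescence: the coupled-from-the-past middle bits

`Coal y m` certifies that the sweep of the rows `y-m, …, y` has forgotten its start at row `y`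
(soundness hypothesis `hCs`). Consequences: deeper sweeps give the same row-`y` bits, and the
"first certified depth" bits — the output of the coupling-from-the-past sampler — agree with every
certified sweep. -/

section Coal

variable {i : ℤ} {Φ : ℤ → Obs × Set (Site 2 × Site 2) → Rnd → Obs → Obs}
  {T : ℕ → ℤ → Obs × Set (Site 2 × Site 2) → Rnd → Obs → Obs}
  {Coal : ℤ → ℕ → Set ((Obs × Set (Site 2 × Site 2)) × Rnd)}

/-- A certified sweep forgets its start: any deeper sweep, from any start, produces the certified row-`y`
middle bits. [folklore] -/
theorem ps2_sweep_sound_of_le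
    (hT : ∀ n a p u z, T n a p u z = ((fun q : ℤ × Obs => (q.1 + 1, Φ q.1 p u q.2))^[n] (a, z)).2)
    (hCs : ∀ (y : ℤ) (m : ℕ) (p : Obs × Set (Site 2 × Site 2)) (u : Rnd), (p, u) ∈ Coal y m →
      ∀ z : Obs, (![i + 1, y] ∈ (T (m + 1) (y - m) p u z).1 ↔ ![i + 1, y] ∈ (T (m + 1) (y - m) p u p.1).1) ∧
        (![i, y] ∈ (T (m + 1) (y - m) p u z).2 ↔ ![i, y] ∈ (T (m + 1) (y - m) p u p.1).2) ∧
        (![i + 1, y] ∈ (T (m + 1) (y - m) p u z).2 ↔ ![i + 1, y] ∈ (T (m + 1) (y - m) p u p.1).2))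
    {y : ℤ} {m n : ℕ} {p : Obs × Set (Site 2 × Site 2)} {u : Rnd} (hmem : (p, u) ∈ Coal y m)
    (hmn : m ≤ n) (z : Obs) :
    (![i + 1, y] ∈ (T (n + 1) (y - n) p u z).1 ↔ ![i + 1, y] ∈ (T (m + 1) (y - m) p u p.1).1) ∧
      (![i, y] ∈ (T (n + 1) (y - n) p u z).2 ↔ ![i, y] ∈ (T (m + 1) (y - m) p u p.1).2) ∧
      (![i + 1, y] ∈ (T (n + 1) (y - n) p u z).2 ↔ ![i + 1, y] ∈ (T (m + 1) (y - m) p u p.1).2) := by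
  obtain ⟨d, rfl⟩ := Nat.exists_eq_add_of_le hmn
  have hsplit : T (m + d + 1) (y - (m + d : ℕ)) p u z =
      T (m + 1) (y - m) p u (T d (y - (m + d : ℕ)) p u z) := by
    rw [show m + d + 1 = d + (m + 1) by ring, ps2_sweep_add hT]
    congr 1
    push_cast
    ring
  rw [hsplit]
  exact hCs y m p u hmem _

/-- THE COUPLED-FROM-THE-PAST BITS: on the event that some depth `≤ n` is certified at row `y`, the
"first certified depth" row-`y` bits coincide with those of ANY sweep of depth `n` ending at row `y`, from
any start. [folklore] -/
theorem ps2_cftp_bits_eq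
    (hT : ∀ n a p u z, T n a p u z = ((fun q : ℤ × Obs => (q.1 + 1, Φ q.1 p u q.2))^[n] (a, z)).2)
    (hCs : ∀ (y : ℤ) (m : ℕ) (p : Obs × Set (Site 2 × Site 2)) (u : Rnd), (p, u) ∈ Coal y m →
      ∀ z : Obs, (![i + 1, y] ∈ (T (m + 1) (y - m) p u z).1 ↔ ![i + 1, y] ∈ (T (m + 1) (y - m) p u p.1).1) ∧
        (![i, y] ∈ (T (m + 1) (y - m) p u z).2 ↔ ![i, y] ∈ (T (m + 1) (y - m) p u p.1).2) ∧
        (![i + 1, y] ∈ (T (m + 1) (y - m) p u z).2 ↔ ![i + 1, y] ∈ (T (m + 1) (y - m) p u p.1).2))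
    {y : ℤ} {n : ℕ} {p : Obs × Set (Site 2 × Site 2)} {u : Rnd} (hex : ∃ m ≤ n, (p, u) ∈ Coal y m)
    (z : Obs) :
    ((∃ m : ℕ, ((p, u) ∈ Coal y m ∧ ∀ m' < m, (p, u) ∉ Coal y m') ∧
        ![i + 1, y] ∈ (T (m + 1) (y - m) p u p.1).1) ↔ ![i + 1, y] ∈ (T (n + 1) (y - n) p u z).1) ∧
    ((∃ m : ℕ, ((p, u) ∈ Coal y m ∧ ∀ m' < m, (p, u) ∉ Coal y m') ∧
        ![i, y] ∈ (T (m + 1) (y - m) p u p.1).2) ↔ ![i, y] ∈ (T (n + 1) (y - n) p u z).2) ∧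
    ((∃ m : ℕ, ((p, u) ∈ Coal y m ∧ ∀ m' < m, (p, u) ∉ Coal y m') ∧
        ![i + 1, y] ∈ (T (m + 1) (y - m) p u p.1).2) ↔ ![i + 1, y] ∈ (T (n + 1) (y - n) p u z).2) := by
  obtain ⟨m₀, hm₀n, hm₀⟩ := hex
  have hexm : ∃ m, (p, u) ∈ Coal y m := ⟨m₀, hm₀⟩
  set M := Nat.find hexm with hM
  have hMmem : (p, u) ∈ Coal y M := Nat.find_spec hexm
  have hMmin : ∀ m' < M, (p, u) ∉ Coal y m' := fun m' hm' => Nat.find_min hexm hm'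
  have hMn : M ≤ n := (Nat.find_min' hexm hm₀).trans hm₀n
  -- the minimal certified depth is unique
  have huniq : ∀ m, ((p, u) ∈ Coal y m ∧ ∀ m' < m, (p, u) ∉ Coal y m') → m = M := by
    rintro m ⟨hm, hmin⟩
    refine le_antisymm ?_ (Nat.find_min' hexm hm)
    by_contra hlt
    exact hmin M (not_le.1 hlt) hMmem
  have key := ps2_sweep_sound_of_le hT hCs hMmem hMn z
  have hred : ∀ Q : ℕ → Prop, (∃ m, ((p, u) ∈ Coal y m ∧ ∀ m' < m, (p, u) ∉ Coal y m') ∧ Q m) ↔ Q M := by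
    intro Q
    constructor
    · rintro ⟨m, hm, hQ⟩
      rwa [huniq m hm] at hQ
    · exact fun hQ => ⟨M, ⟨hMmem, hMmin⟩, hQ⟩
  refine ⟨?_, ?_, ?_⟩
  · rw [hred (fun m => ![i + 1, y] ∈ (T (m + 1) (y - m) p u p.1).1), key.1]
  · rw [hred (fun m => ![i, y] ∈ (T (m + 1) (y - m) p u p.1).2), key.2.1]
  · rw [hred (fun m => ![i + 1, y] ∈ (T (m + 1) (y - m) p u p.1).2), key.2.2]

end Coal

end Summit.CriticalPhenomena.CardyFormulaZ2.Theorems.IKLinearTransport.PinnedDiagramExchange
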